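import Summits.BirchSwinnertonDyer.BirchSwinnertonDyer.Theorems.PrintX10bStubReadoutLocalClausesKS
import HarnessLib

/-!
# The three place-wise (B5) KS-clauses AT EVERY CLASS NUMBER (finding «hhK-IDLE», bsd-line-x10b-p1 LEAD g11 2026-08-29T02:41Z; K2a)
# — `readoutLocalOffKS_anyClassNumber`, `readoutLocalIndexBadKS_anyClassNumber`, `readoutLocalIndexPKS_anyClassNumber`

Cell `run/shared/lean/pub/bsd-print-x9/`, seat bsd-line-x10b-p1-w8 g9 («MINE K2» 02:47Z under LEAD g11's K-plan). Summits-side,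
THEOREMS ONLY (no abbrev/def, no named fact, no instance, no `sorry`), ROUTE-INDEPENDENT (no `Theses` import),
`--supports stmt-BirchSwinnertonDyer-23055` (helper). HONEST FRAMING: nothing is closed; «beyond-print theorem»: no. BSD is not proved
by any of this; no summit statement is proved by this seat.

WHY. The KS μ-chain letters (`Stmt.readoutLocal{Off,IndexP,IndexBad}KS`, `PrintX10bReadoutIndexOfLocalClausesKS`, x10b-p1 LEAD g10)
carry three binders that NO proof uses — `¬ W.HasCM`, `MastellaZerman2026.HasPadicScalarImage W p`, `p ∣ NumberField.classNumber K`
(the closers `stub_readoutLocal{Off,IndexBad,IndexP}KS`, p684525, introduce them as `_hCM _hsc _hhK`). This file states each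
clause with EXACTLY those three binders deleted (the leading `Stmt.kummerStrictOnFrames`, `hirr`, `hirrK`, `hHp` kept in place and
order; everything else byte-identical to the letter) and proves it by the landed proof verbatim. So the place-wise clauses hold on
EVERY μ-frame, `3 ∣ h_K` or not — the first brick of LEAD g11's class-number-free re-thread (K1–K4), which removes Mastella–Zerman
2026 Cor. 4.6 (`h46`, the `3 ∤ h_K` branch) from the census of crux 23055.

* §1 `readoutLocalOffKS_anyClassNumber` — (B5-OFF), `m₁ := 0`, `j₀ := 0` (proof = `stub_readoutLocalOffKS`).
* §2 `readoutLocalIndexBadKS_anyClassNumber` — (B5-BAD), `c := 8 p^e`, `Fv := ⊤` (proof = `stub_readoutLocalIndexBadKS`).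
* §3 `readoutLocalIndexPKS_anyClassNumber` — (B5-P), `c := 2 p^s` (proof = `stub_readoutLocalIndexPKS`; the ONE place where a kept
  binder is used: `hHp` feeds the frame-restricted Kummer = strict letter at `v ∣ p`).

References: [Howard2004HeegnerKolyvagin] Lemma 2.2.7 / Prop. 2.2.8, Lemma 3.2.7, proof of Thm. 2.2.10 (𝔮 = T^m + p);
[GreenbergLNM1716] §2–§4; [Brink2007] Thm. 2, Cor. 1; [MilneADT2006] I Cor. 2.3, Thm. 2.8; [SilvermanAEC2009] Prop. VII.4.1.
-/

set_option linter.dupNamespace false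
set_option autoImplicit false

noncomputable section

open scoped Classical Pointwise ContRepresentation TensorProduct NumberField

open Function NumberField IsDedekindDomain Field
open Literature Literature.NumberTheory.EllipticCurves WeierstrassCurve
open Literature.NumberTheory.GaloisCohomology Literature.NumberTheory.GaloisCohomology.Howard2004
open Literature.NumberTheory.GaloisRepresentations Literature.NumberTheory.GaloisRepresentations.DiscreteGaloisModule
open Literature.NumberTheory.EllipticCurves.GreenbergSelmer
open Summit.BirchSwinnertonDyer.BirchSwinnertonDyer.Theorems
open Literature.NumberTheory.EllipticCurves.ZpExtension (EisensteinLevel)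

namespace Summit.BirchSwinnertonDyer.BirchSwinnertonDyer.Theorems.HeegnerMuPartControlGlue

/-! ## §1 (B5-OFF) -/

set_option synthInstance.maxHeartbeats 80000 in
/-- **(B5-OFF) at every class number** — the KS-letter `Stmt.readoutLocalOffKS` with the three idle binders (`¬ CM`, scalar
image, `p ∣ h_K`) deleted: at the finite places outside `S`, a class whose readout lies in `Sel_{p^∞}(E/K_∞)` has
`loc_v c ∈ condA F j v` («no contribution at the good places»; `m₁ := 0`, `j₀ := 0`). Proof verbatim `stub_readoutLocalOffKS`.
[cite: Howard2004HeegnerKolyvagin, Def. 2.1.10, Lemma 2.2.7 / Prop. 2.2.8 and proof of Thm. 2.2.10 (arXiv p. 17 L41–53)]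
[cite: GreenbergLNM1716, §2 Prop. 2.1 and §4 pp. 107, 124] [cite: GreenbergVatsal2000, §2 p. 17] [cite: SilvermanAEC2009, Prop. VII.4.1] -/
theorem readoutLocalOffKS_anyClassNumber :
    Stmt.kummerStrictOnFrames →
    ∀ (N : ℕ) [NeZero N] (W : WeierstrassCurve ℚ) [W.IsGloballyMinimal] (K : Type) [Field K] [NumberField K]
      (p : ℕ) [Fact p.Prime] (κ : ZpExtension K p) (γ : Field.absoluteGaloisGroup K)
      (jbar : AlgebraicClosure K →+* ℂ) (hyp : CastellaGrossiLeeSkinner2022.Thm413Hypotheses N W K p κ γ),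
      W.HasIrreducibleModPGaloisRep p → (W.baseChange K).HasIrreducibleModPGaloisRep p →
      SatisfiesHeegnerHypothesis p K →
      ∃ m₁ : ℕ, ∀ (m : ℕ) (hm : 1 ≤ m), m₁ ≤ m →
        haveI := hyp.isElliptic
        letI := IwasawaAlgebra.isDomain_quotient_X_pow_add_C p hm
        letI := IwasawaAlgebra.isDiscreteValuationRing_quotient_X_pow_add_C p hm
        haveI := IwasawaAlgebra.EisensteinCoeff.isLocalRing_succ p hm
        letI := IwasawaAlgebra.EisensteinCoeff.algebraOfSpecSucc p m
        haveI := W.isScalarTower_algebraOfSpecSucc (K := K) (p := p) (m := m)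
        letI := W.residueModuleSucc (K := K) (p := p) hm
        ∀ (S : Finset (IsDedekindDomain.HeightOneSpectrum (NumberField.RingOfIntegers K)))
          (hpS : ∀ v, ((p : ℕ) : NumberField.RingOfIntegers K) ∈ v.asIdeal → v ∈ S)
          (hbad : ∀ v, v ∉ S → ((p : ℕ) : NumberField.RingOfIntegers K) ∉ v.asIdeal →
            (W.baseChange K).HasGoodReductionAt v)
          (_hSN : ∀ v ∈ S, ((p : ℕ) : NumberField.RingOfIntegers K) ∈ v.asIdeal ∨
            ((N : ℕ) : NumberField.RingOfIntegers K) ∈ v.asIdeal)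
          (_hSσ : ∀ (σ : K ≃ₐ[ℚ] K) (v : IsDedekindDomain.HeightOneSpectrum (NumberField.RingOfIntegers K)),
            σ • v ∈ S → v ∈ S)
          (L : Set (IsDedekindDomain.HeightOneSpectrum (NumberField.RingOfIntegers K)))
          (hL : L ⊆ (W.eisensteinTower (κ.unitTwist (-1)) hm).degreeTwoPrimes p)
          (hLS : ∀ v ∈ L, v ∉ S) (jbar' : AlgebraicClosure K →+* ℂ) (cd : ConjugationDatum K)
          (Dd : ∀ k, DualityDatum p cd ((W.eisensteinTower (κ.unitTwist (-1)) hm).ρ k)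
            (IwasawaAlgebra.EisensteinCoeff p m (k + 1)))
          (fs : ∀ (k : ℕ) (n : Finset (IsDedekindDomain.HeightOneSpectrum (NumberField.RingOfIntegers K)))
            (v : IsDedekindDomain.HeightOneSpectrum (NumberField.RingOfIntegers K)),
            galoisCohomology ((W.eisensteinLevelQuot (κ.unitTwist (-1)) hm k n).toLocal (Sum.inr v)) 1 →+
              SingularQuotient (GaloisRep.toLocal v (W.eisensteinLevelQuot (κ.unitTwist (-1)) hm k n)) ⊗[ℤ]
                Gell v)
          (hy : (W.eisensteinDVRSetting (κ.unitTwist (-1)) hm S hpS hbad L hL hLS jbar' cd Dd fs).SatisfiesH)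
          (hπ : (W.eisensteinDVRSetting (κ.unitTwist (-1)) hm S hpS hbad L hL hLS jbar' cd Dd fs).π ∈ IsLocalRing.maximalIdeal (IwasawaAlgebra p ⧸ Ideal.span {(PowerSeries.X ^ m + PowerSeries.C (p : ℤ_[p]) : IwasawaAlgebra p)}))
          (he : ∀ k, (W.eisensteinDVRSetting (κ.unitTwist (-1)) hm S hpS hbad L hL hLS jbar' cd Dd fs).e k ≤ (W.eisensteinDVRSetting (κ.unitTwist (-1)) hm S hpS hbad L hL hLS jbar' cd Dd fs).e (k + 1))
          (hπX : (W.eisensteinDVRSetting (κ.unitTwist (-1)) hm S hpS hbad L hL hLS jbar' cd Dd fs).π =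
            Ideal.Quotient.mk (Ideal.span {(PowerSeries.X ^ m + PowerSeries.C (p : ℤ_[p]) : IwasawaAlgebra p)}) PowerSeries.X)
          (hek : ∀ k, (W.eisensteinDVRSetting (κ.unitTwist (-1)) hm S hpS hbad L hL hLS jbar' cd Dd fs).e (k + 1) - (W.eisensteinDVRSetting (κ.unitTwist (-1)) hm S hpS hbad L hL hLS jbar' cd Dd fs).e k = m),
          ∃ j₀ : ℕ, ∀ (j : ℕ), j₀ ≤ j → ∀ c : galoisCohomology ((W.eisensteinDVRSetting (κ.unitTwist (-1)) hm S hpS hbad L hL hLS jbar' cd Dd fs).T.ρ j) 1,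
            W.eisensteinTowerReadout κ hm (W.eisensteinDVRSetting (κ.unitTwist (-1)) hm S hpS hbad L hL hLS jbar' cd Dd fs).π (W.eisensteinDVRSetting (κ.unitTwist (-1)) hm S hpS hbad L hL hLS jbar' cd Dd fs).e hy.killed hy.ker_red hπ he hπX hek
                (AddCommGroup.DirectLimit.of (fun k => galoisCohomology ((W.eisensteinDVRSetting (κ.unitTwist (-1)) hm S hpS hbad L hL hLS jbar' cd Dd fs).T.ρ k) 1)
                  (AdicTower.incH1LE (W.eisensteinDVRSetting (κ.unitTwist (-1)) hm S hpS hbad L hL hLS jbar' cd Dd fs).T (W.eisensteinDVRSetting (κ.unitTwist (-1)) hm S hpS hbad L hL hLS jbar' cd Dd fs).π (W.eisensteinDVRSetting (κ.unitTwist (-1)) hm S hpS hbad L hL hLS jbar' cd Dd fs).e hy.killed hy.ker_red hπ he) j c) ∈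
              (W.baseChange K).selmerInfty κ →
            ∀ v : IsDedekindDomain.HeightOneSpectrum (NumberField.RingOfIntegers K), v ∉ S →
              galoisCohomology.localization ((W.eisensteinDVRSetting (κ.unitTwist (-1)) hm S hpS hbad L hL hLS jbar' cd Dd fs).T.ρ j) (Sum.inr v) 1 c ∈
                AdicTower.condA (W.eisensteinDVRSetting (κ.unitTwist (-1)) hm S hpS hbad L hL hLS jbar' cd Dd fs).T (W.eisensteinDVRSetting (κ.unitTwist (-1)) hm S hpS hbad L hL hLS jbar' cd Dd fs).π (W.eisensteinDVRSetting (κ.unitTwist (-1)) hm S hpS hbad L hL hLS jbar' cd Dd fs).e hy.killed hy.ker_red hπ he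
                  (fun k => ((W.eisensteinDVRSetting (κ.unitTwist (-1)) hm S hpS hbad L hL hLS jbar' cd Dd fs).t k).cond) j (Sum.inr v) := by
  intro _hKS N _ W _ K _ _ p _ κ γ jbar hyp _hirr _hirrK _hHp
  haveI := hyp.isElliptic
  refine ⟨0, fun m hm _ ↦ ?_⟩
  letI := IwasawaAlgebra.isDomain_quotient_X_pow_add_C p hm
  letI := IwasawaAlgebra.isDiscreteValuationRing_quotient_X_pow_add_C p hm
  haveI := IwasawaAlgebra.EisensteinCoeff.isLocalRing_succ p hm
  letI := IwasawaAlgebra.EisensteinCoeff.algebraOfSpecSucc p m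
  haveI := W.isScalarTower_algebraOfSpecSucc (K := K) (p := p) (m := m)
  letI := W.residueModuleSucc (K := K) (p := p) hm
  intro S hpS hbad _hSN _hSσ L hL hLS jbar' cd Dd fs hy hπ he hπX hek
  refine ⟨0, fun j _ c hc v hvS ↦ ?_⟩
  have hpv : ((p : ℕ) : 𝓞 K) ∉ v.asIdeal := fun h ↦ hvS (hpS v h)
  -- `F ≤ condA F`: the `d = 0` term of the directed union
  unfold AdicTower.condA
  refine AddSubgroup.mem_iSup_of_mem 0 ?_
  rw [AddSubgroup.mem_comap]
  exact localization_mem_eisensteinSelmerStructure_of_eisensteinTowerReadout_mem_selmerInfty W κ hm _ _ hy.killed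
    hy.ker_red hπ he hπX hek hyp.topGenerator S hbad v hvS hpv j c hc

/-! ## §2 (B5-BAD) -/

set_option maxHeartbeats 1600000 in
set_option synthInstance.maxHeartbeats 80000 in
/-- **(B5-BAD) at every class number** — the KS-letter `Stmt.readoutLocalIndexBadKS` with the three idle binders deleted: at the
places `v ∈ S` away from `p` (so `v ∣ N`) a relaxed local condition (`Fv := ⊤`) of index `≤ p^c`, `c := 8 p^e` independent of `m`,
`j` and the datum (`m₁ := 2 p^e + 1`, `j₀ := 0`). Proof verbatim `stub_readoutLocalIndexBadKS`.
[cite: Howard2004HeegnerKolyvagin, Lemma 2.2.7 / Prop. 2.2.8 and proof of Thm. 2.2.10 (𝔮 = T^m + p)] [cite: MilneADT2006, I Thm. 2.8]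
[cite: Brink2007, Thm. 2 and Cor. 1] -/
theorem readoutLocalIndexBadKS_anyClassNumber :
    Stmt.kummerStrictOnFrames →
    ∀ (N : ℕ) [NeZero N] (W : WeierstrassCurve ℚ) [W.IsGloballyMinimal] (K : Type) [Field K] [NumberField K]
      (p : ℕ) [Fact p.Prime] (κ : ZpExtension K p) (γ : Field.absoluteGaloisGroup K)
      (jbar : AlgebraicClosure K →+* ℂ) (hyp : CastellaGrossiLeeSkinner2022.Thm413Hypotheses N W K p κ γ),
      W.HasIrreducibleModPGaloisRep p → (W.baseChange K).HasIrreducibleModPGaloisRep p →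
      SatisfiesHeegnerHypothesis p K →
      ∃ c m₁ : ℕ, ∀ (m : ℕ) (hm : 1 ≤ m), m₁ ≤ m →
        haveI := hyp.isElliptic
        letI := IwasawaAlgebra.isDomain_quotient_X_pow_add_C p hm
        letI := IwasawaAlgebra.isDiscreteValuationRing_quotient_X_pow_add_C p hm
        haveI := IwasawaAlgebra.EisensteinCoeff.isLocalRing_succ p hm
        letI := IwasawaAlgebra.EisensteinCoeff.algebraOfSpecSucc p m
        haveI := W.isScalarTower_algebraOfSpecSucc (K := K) (p := p) (m := m)
        letI := W.residueModuleSucc (K := K) (p := p) hm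
        ∀ (S : Finset (IsDedekindDomain.HeightOneSpectrum (NumberField.RingOfIntegers K)))
          (hpS : ∀ v, ((p : ℕ) : NumberField.RingOfIntegers K) ∈ v.asIdeal → v ∈ S)
          (hbad : ∀ v, v ∉ S → ((p : ℕ) : NumberField.RingOfIntegers K) ∉ v.asIdeal →
            (W.baseChange K).HasGoodReductionAt v)
          (_hSN : ∀ v ∈ S, ((p : ℕ) : NumberField.RingOfIntegers K) ∈ v.asIdeal ∨
            ((N : ℕ) : NumberField.RingOfIntegers K) ∈ v.asIdeal)
          (_hSσ : ∀ (σ : K ≃ₐ[ℚ] K) (v : IsDedekindDomain.HeightOneSpectrum (NumberField.RingOfIntegers K)),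
            σ • v ∈ S → v ∈ S)
          (L : Set (IsDedekindDomain.HeightOneSpectrum (NumberField.RingOfIntegers K)))
          (hL : L ⊆ (W.eisensteinTower (κ.unitTwist (-1)) hm).degreeTwoPrimes p)
          (hLS : ∀ v ∈ L, v ∉ S) (jbar' : AlgebraicClosure K →+* ℂ) (cd : ConjugationDatum K)
          (Dd : ∀ k, DualityDatum p cd ((W.eisensteinTower (κ.unitTwist (-1)) hm).ρ k)
            (IwasawaAlgebra.EisensteinCoeff p m (k + 1)))
          (fs : ∀ (k : ℕ) (n : Finset (IsDedekindDomain.HeightOneSpectrum (NumberField.RingOfIntegers K)))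
            (v : IsDedekindDomain.HeightOneSpectrum (NumberField.RingOfIntegers K)),
            galoisCohomology ((W.eisensteinLevelQuot (κ.unitTwist (-1)) hm k n).toLocal (Sum.inr v)) 1 →+
              SingularQuotient (GaloisRep.toLocal v (W.eisensteinLevelQuot (κ.unitTwist (-1)) hm k n)) ⊗[ℤ]
                Gell v)
          (hy : (W.eisensteinDVRSetting (κ.unitTwist (-1)) hm S hpS hbad L hL hLS jbar' cd Dd fs).SatisfiesH)
          (hπ : (W.eisensteinDVRSetting (κ.unitTwist (-1)) hm S hpS hbad L hL hLS jbar' cd Dd fs).π ∈ IsLocalRing.maximalIdeal (IwasawaAlgebra p ⧸ Ideal.span {(PowerSeries.X ^ m + PowerSeries.C (p : ℤ_[p]) : IwasawaAlgebra p)}))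
          (he : ∀ k, (W.eisensteinDVRSetting (κ.unitTwist (-1)) hm S hpS hbad L hL hLS jbar' cd Dd fs).e k ≤ (W.eisensteinDVRSetting (κ.unitTwist (-1)) hm S hpS hbad L hL hLS jbar' cd Dd fs).e (k + 1))
          (hπX : (W.eisensteinDVRSetting (κ.unitTwist (-1)) hm S hpS hbad L hL hLS jbar' cd Dd fs).π =
            Ideal.Quotient.mk (Ideal.span {(PowerSeries.X ^ m + PowerSeries.C (p : ℤ_[p]) : IwasawaAlgebra p)}) PowerSeries.X)
          (hek : ∀ k, (W.eisensteinDVRSetting (κ.unitTwist (-1)) hm S hpS hbad L hL hLS jbar' cd Dd fs).e (k + 1) - (W.eisensteinDVRSetting (κ.unitTwist (-1)) hm S hpS hbad L hL hLS jbar' cd Dd fs).e k = m),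
          ∃ j₀ : ℕ, ∀ (j : ℕ), j₀ ≤ j →
            ∀ v ∈ S, ((p : ℕ) : NumberField.RingOfIntegers K) ∉ v.asIdeal →
              ∃ Fv : AddSubgroup (galoisCohomology (((W.eisensteinDVRSetting (κ.unitTwist (-1)) hm S hpS hbad L hL hLS jbar' cd Dd fs).T.ρ j).toLocal (Sum.inr v)) 1),
                (∀ c : galoisCohomology ((W.eisensteinDVRSetting (κ.unitTwist (-1)) hm S hpS hbad L hL hLS jbar' cd Dd fs).T.ρ j) 1,
                  W.eisensteinTowerReadout κ hm (W.eisensteinDVRSetting (κ.unitTwist (-1)) hm S hpS hbad L hL hLS jbar' cd Dd fs).π (W.eisensteinDVRSetting (κ.unitTwist (-1)) hm S hpS hbad L hL hLS jbar' cd Dd fs).e hy.killed hy.ker_red hπ he hπX hek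
                (AddCommGroup.DirectLimit.of (fun k => galoisCohomology ((W.eisensteinDVRSetting (κ.unitTwist (-1)) hm S hpS hbad L hL hLS jbar' cd Dd fs).T.ρ k) 1)
                  (AdicTower.incH1LE (W.eisensteinDVRSetting (κ.unitTwist (-1)) hm S hpS hbad L hL hLS jbar' cd Dd fs).T (W.eisensteinDVRSetting (κ.unitTwist (-1)) hm S hpS hbad L hL hLS jbar' cd Dd fs).π (W.eisensteinDVRSetting (κ.unitTwist (-1)) hm S hpS hbad L hL hLS jbar' cd Dd fs).e hy.killed hy.ker_red hπ he) j c) ∈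
              (W.baseChange K).selmerInfty κ →
                  galoisCohomology.localization ((W.eisensteinDVRSetting (κ.unitTwist (-1)) hm S hpS hbad L hL hLS jbar' cd Dd fs).T.ρ j) (Sum.inr v) 1 c ∈ Fv) ∧
                Finite (↥Fv ⧸ (AdicTower.condA (W.eisensteinDVRSetting (κ.unitTwist (-1)) hm S hpS hbad L hL hLS jbar' cd Dd fs).T (W.eisensteinDVRSetting (κ.unitTwist (-1)) hm S hpS hbad L hL hLS jbar' cd Dd fs).π (W.eisensteinDVRSetting (κ.unitTwist (-1)) hm S hpS hbad L hL hLS jbar' cd Dd fs).e hy.killed hy.ker_red hπ he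
                  (fun k => ((W.eisensteinDVRSetting (κ.unitTwist (-1)) hm S hpS hbad L hL hLS jbar' cd Dd fs).t k).cond) j (Sum.inr v)).addSubgroupOf Fv) ∧
                Nat.card (↥Fv ⧸ (AdicTower.condA (W.eisensteinDVRSetting (κ.unitTwist (-1)) hm S hpS hbad L hL hLS jbar' cd Dd fs).T (W.eisensteinDVRSetting (κ.unitTwist (-1)) hm S hpS hbad L hL hLS jbar' cd Dd fs).π (W.eisensteinDVRSetting (κ.unitTwist (-1)) hm S hpS hbad L hL hLS jbar' cd Dd fs).e hy.killed hy.ker_red hπ he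
                  (fun k => ((W.eisensteinDVRSetting (κ.unitTwist (-1)) hm S hpS hbad L hL hLS jbar' cd Dd fs).t k).cond) j (Sum.inr v)).addSubgroupOf Fv) ≤ p ^ c := by
  intro _hKS N _ W _ K _ _ p _ κ γ jbar hyp _hirr _hirrK _hHp
  haveI := hyp.isElliptic
  have hN0 : N ≠ 0 := NeZero.ne N
  -- one exponent `e` for `κ⁻¹ = κ.unitTwist (-1)` over the places above `N` away from `p`
  have hdec : ∀ v : HeightOneSpectrum (𝓞 K), ((N : ℕ) : 𝓞 K) ∈ v.asIdeal → ((p : ℕ) : 𝓞 K) ∉ v.asIdeal →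
      ¬ (GreenbergSelmer.decomp v ≤ κ.kerSubgroup) := fun v hNv hpv ↦
    ZpExtension.decomp_not_le_kerSubgroup_of_natCast_mem_of_satisfiesHeegnerHypothesis hyp.isImaginaryQuadratic κ
      hyp.anticyclotomic hyp.heegner hN0 v hpv hNv
  have hobt1 := ZpExtension.exists_forall_toAdd_apply_absGaloisRestrict_eq_pow_of_natCast_mem κ hN0 hdec
  obtain ⟨e, he⟩ := hobt1
  refine ⟨8 * p ^ e, 2 * p ^ e + 1, fun m hm hm₁ ↦ ?_⟩
  letI := IwasawaAlgebra.isDomain_quotient_X_pow_add_C p hm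
  letI := IwasawaAlgebra.isDiscreteValuationRing_quotient_X_pow_add_C p hm
  haveI := IwasawaAlgebra.EisensteinCoeff.isLocalRing_succ p hm
  letI := IwasawaAlgebra.EisensteinCoeff.algebraOfSpecSucc p m
  haveI := W.isScalarTower_algebraOfSpecSucc (K := K) (p := p) (m := m)
  letI := W.residueModuleSucc (K := K) (p := p) hm
  intro S hpS hbad hSN hSσ L hL hLS jbar' cd Dd fs hy hπ he' hπX hek
  refine ⟨0, fun j _ v hvS hpv ↦ ?_⟩
  have hobt2 := he v ((hSN v hvS).resolve_left hpv) hpv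
  obtain ⟨h, hh⟩ := hobt2
  have hh' : ((κ.unitTwist (-1)) (absGaloisRestrict K (v.adicCompletion K) h⁻¹)).toAdd = ((p ^ e : ℕ) : ℤ_[p]) := by
    rw [ZpExtension.unitTwist_apply, toAdd_ofAdd, map_inv, map_inv, toAdd_inv, hh, Units.val_neg, Units.val_one,
      neg_one_mul, neg_neg]
  refine ⟨⊤, fun c _ ↦ AddSubgroup.mem_top _, ?_⟩
  exact W.finite_and_natCard_top_quotient_le_pow_eisensteinTower κ hm v hpv h⁻¹ (Nat.one_le_pow _ _ (Fact.out : p.Prime).pos)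
    hh' (by omega) j _

/-! ## §3 (B5-P) -/

set_option maxHeartbeats 1600000 in
set_option synthInstance.maxHeartbeats 80000 in
/-- **(B5-P) at every class number** — the KS-letter `Stmt.readoutLocalIndexPKS` with the three idle binders deleted: at the
places `v ∈ S` above `p` a relaxed local condition containing the local classes, of index `≤ p^c`, `c := 2 p^s` independent of
`m`, `j` and the datum (`m₁ := p^s + 1`, `j₀ := 0`); the frame-restricted Kummer = strict letter `hKS` is consumed at `v ∣ p` with
the kept binder `hHp : SatisfiesHeegnerHypothesis p K` and the frame facts of `Thm413Hypotheses`. Proof verbatim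
`stub_readoutLocalIndexPKS`. [cite: Howard2004HeegnerKolyvagin, Lemma 2.2.7 / Prop. 2.2.8, Lemma 3.2.7 and proof of Thm. 2.2.10 (𝔮 = T^m + p)]
[cite: GreenbergLNM1716, §2–§3] [cite: Brink2007, Cor. 1] [cite: MilneADT2006, I Cor. 2.3] -/
theorem readoutLocalIndexPKS_anyClassNumber :
    Stmt.kummerStrictOnFrames →
    ∀ (N : ℕ) [NeZero N] (W : WeierstrassCurve ℚ) [W.IsGloballyMinimal] (K : Type) [Field K] [NumberField K]
      (p : ℕ) [Fact p.Prime] (κ : ZpExtension K p) (γ : Field.absoluteGaloisGroup K)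
      (jbar : AlgebraicClosure K →+* ℂ) (hyp : CastellaGrossiLeeSkinner2022.Thm413Hypotheses N W K p κ γ),
      W.HasIrreducibleModPGaloisRep p → (W.baseChange K).HasIrreducibleModPGaloisRep p →
      SatisfiesHeegnerHypothesis p K →
      ∃ c m₁ : ℕ, ∀ (m : ℕ) (hm : 1 ≤ m), m₁ ≤ m →
        haveI := hyp.isElliptic
        letI := IwasawaAlgebra.isDomain_quotient_X_pow_add_C p hm
        letI := IwasawaAlgebra.isDiscreteValuationRing_quotient_X_pow_add_C p hm
        haveI := IwasawaAlgebra.EisensteinCoeff.isLocalRing_succ p hm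
        letI := IwasawaAlgebra.EisensteinCoeff.algebraOfSpecSucc p m
        haveI := W.isScalarTower_algebraOfSpecSucc (K := K) (p := p) (m := m)
        letI := W.residueModuleSucc (K := K) (p := p) hm
        ∀ (S : Finset (IsDedekindDomain.HeightOneSpectrum (NumberField.RingOfIntegers K)))
          (hpS : ∀ v, ((p : ℕ) : NumberField.RingOfIntegers K) ∈ v.asIdeal → v ∈ S)
          (hbad : ∀ v, v ∉ S → ((p : ℕ) : NumberField.RingOfIntegers K) ∉ v.asIdeal →
            (W.baseChange K).HasGoodReductionAt v)
          (_hSN : ∀ v ∈ S, ((p : ℕ) : NumberField.RingOfIntegers K) ∈ v.asIdeal ∨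
            ((N : ℕ) : NumberField.RingOfIntegers K) ∈ v.asIdeal)
          (_hSσ : ∀ (σ : K ≃ₐ[ℚ] K) (v : IsDedekindDomain.HeightOneSpectrum (NumberField.RingOfIntegers K)),
            σ • v ∈ S → v ∈ S)
          (L : Set (IsDedekindDomain.HeightOneSpectrum (NumberField.RingOfIntegers K)))
          (hL : L ⊆ (W.eisensteinTower (κ.unitTwist (-1)) hm).degreeTwoPrimes p)
          (hLS : ∀ v ∈ L, v ∉ S) (jbar' : AlgebraicClosure K →+* ℂ) (cd : ConjugationDatum K)
          (Dd : ∀ k, DualityDatum p cd ((W.eisensteinTower (κ.unitTwist (-1)) hm).ρ k)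
            (IwasawaAlgebra.EisensteinCoeff p m (k + 1)))
          (fs : ∀ (k : ℕ) (n : Finset (IsDedekindDomain.HeightOneSpectrum (NumberField.RingOfIntegers K)))
            (v : IsDedekindDomain.HeightOneSpectrum (NumberField.RingOfIntegers K)),
            galoisCohomology ((W.eisensteinLevelQuot (κ.unitTwist (-1)) hm k n).toLocal (Sum.inr v)) 1 →+
              SingularQuotient (GaloisRep.toLocal v (W.eisensteinLevelQuot (κ.unitTwist (-1)) hm k n)) ⊗[ℤ]
                Gell v)
          (hy : (W.eisensteinDVRSetting (κ.unitTwist (-1)) hm S hpS hbad L hL hLS jbar' cd Dd fs).SatisfiesH)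
          (hπ : (W.eisensteinDVRSetting (κ.unitTwist (-1)) hm S hpS hbad L hL hLS jbar' cd Dd fs).π ∈ IsLocalRing.maximalIdeal (IwasawaAlgebra p ⧸ Ideal.span {(PowerSeries.X ^ m + PowerSeries.C (p : ℤ_[p]) : IwasawaAlgebra p)}))
          (he : ∀ k, (W.eisensteinDVRSetting (κ.unitTwist (-1)) hm S hpS hbad L hL hLS jbar' cd Dd fs).e k ≤ (W.eisensteinDVRSetting (κ.unitTwist (-1)) hm S hpS hbad L hL hLS jbar' cd Dd fs).e (k + 1))
          (hπX : (W.eisensteinDVRSetting (κ.unitTwist (-1)) hm S hpS hbad L hL hLS jbar' cd Dd fs).π =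
            Ideal.Quotient.mk (Ideal.span {(PowerSeries.X ^ m + PowerSeries.C (p : ℤ_[p]) : IwasawaAlgebra p)}) PowerSeries.X)
          (hek : ∀ k, (W.eisensteinDVRSetting (κ.unitTwist (-1)) hm S hpS hbad L hL hLS jbar' cd Dd fs).e (k + 1) - (W.eisensteinDVRSetting (κ.unitTwist (-1)) hm S hpS hbad L hL hLS jbar' cd Dd fs).e k = m),
          ∃ j₀ : ℕ, ∀ (j : ℕ), j₀ ≤ j →
            ∀ v ∈ S, ((p : ℕ) : NumberField.RingOfIntegers K) ∈ v.asIdeal →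
              ∃ Fv : AddSubgroup (galoisCohomology (((W.eisensteinDVRSetting (κ.unitTwist (-1)) hm S hpS hbad L hL hLS jbar' cd Dd fs).T.ρ j).toLocal (Sum.inr v)) 1),
                (∀ c : galoisCohomology ((W.eisensteinDVRSetting (κ.unitTwist (-1)) hm S hpS hbad L hL hLS jbar' cd Dd fs).T.ρ j) 1,
                  W.eisensteinTowerReadout κ hm (W.eisensteinDVRSetting (κ.unitTwist (-1)) hm S hpS hbad L hL hLS jbar' cd Dd fs).π (W.eisensteinDVRSetting (κ.unitTwist (-1)) hm S hpS hbad L hL hLS jbar' cd Dd fs).e hy.killed hy.ker_red hπ he hπX hek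
                (AddCommGroup.DirectLimit.of (fun k => galoisCohomology ((W.eisensteinDVRSetting (κ.unitTwist (-1)) hm S hpS hbad L hL hLS jbar' cd Dd fs).T.ρ k) 1)
                  (AdicTower.incH1LE (W.eisensteinDVRSetting (κ.unitTwist (-1)) hm S hpS hbad L hL hLS jbar' cd Dd fs).T (W.eisensteinDVRSetting (κ.unitTwist (-1)) hm S hpS hbad L hL hLS jbar' cd Dd fs).π (W.eisensteinDVRSetting (κ.unitTwist (-1)) hm S hpS hbad L hL hLS jbar' cd Dd fs).e hy.killed hy.ker_red hπ he) j c) ∈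
              (W.baseChange K).selmerInfty κ →
                  galoisCohomology.localization ((W.eisensteinDVRSetting (κ.unitTwist (-1)) hm S hpS hbad L hL hLS jbar' cd Dd fs).T.ρ j) (Sum.inr v) 1 c ∈ Fv) ∧
                Finite (↥Fv ⧸ (AdicTower.condA (W.eisensteinDVRSetting (κ.unitTwist (-1)) hm S hpS hbad L hL hLS jbar' cd Dd fs).T (W.eisensteinDVRSetting (κ.unitTwist (-1)) hm S hpS hbad L hL hLS jbar' cd Dd fs).π (W.eisensteinDVRSetting (κ.unitTwist (-1)) hm S hpS hbad L hL hLS jbar' cd Dd fs).e hy.killed hy.ker_red hπ he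
                  (fun k => ((W.eisensteinDVRSetting (κ.unitTwist (-1)) hm S hpS hbad L hL hLS jbar' cd Dd fs).t k).cond) j (Sum.inr v)).addSubgroupOf Fv) ∧
                Nat.card (↥Fv ⧸ (AdicTower.condA (W.eisensteinDVRSetting (κ.unitTwist (-1)) hm S hpS hbad L hL hLS jbar' cd Dd fs).T (W.eisensteinDVRSetting (κ.unitTwist (-1)) hm S hpS hbad L hL hLS jbar' cd Dd fs).π (W.eisensteinDVRSetting (κ.unitTwist (-1)) hm S hpS hbad L hL hLS jbar' cd Dd fs).e hy.killed hy.ker_red hπ he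
                  (fun k => ((W.eisensteinDVRSetting (κ.unitTwist (-1)) hm S hpS hbad L hL hLS jbar' cd Dd fs).t k).cond) j (Sum.inr v)).addSubgroupOf Fv) ≤ p ^ c := by
  intro hKS N _ W _ K _ _ p _ κ γ jbar hyp _hirr _hirrK hHp
  haveI := hyp.isElliptic
  have hK : IsImaginaryQuadratic K := hyp.isImaginaryQuadratic
  -- every `v ∣ p` is finitely decomposed in `K_∞` (Brink), for `κ⁻¹ = κ.unitTwist (-1)`; one exponent `s` for all of them
  have hdec : ∀ v : HeightOneSpectrum (𝓞 K), ((p : ℕ) : 𝓞 K) ∈ v.asIdeal →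
      ¬ (GreenbergSelmer.decomp v ≤ (κ.unitTwist (-1)).kerSubgroup) := fun v hpv ↦ by
    rw [ZpExtension.kerSubgroup_unitTwist]
    exact ZpExtension.decomp_not_le_kerSubgroup_above_of_isAnticyclotomic_anyPrime K p hK κ hyp.anticyclotomic v hpv
  have hobt1 := exists_forall_toAdd_apply_absGaloisRestrict_eq_pow_of_mem (κ.unitTwist (-1)) hdec
  obtain ⟨s, hs⟩ := hobt1
  -- the frame at `v ∣ p` from `Thm413Hypotheses` (stated before Howard's instance preamble): good reduction, `p ∤ a_v`,
  -- the ordinary point, ramification of `K_∞` at `v`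
  have hgoodv : ∀ v : HeightOneSpectrum (𝓞 K), ((p : ℕ) : 𝓞 K) ∈ v.asIdeal → (W.baseChange K).HasGoodReductionAt v :=
    fun v hpv ↦ W.hasGoodReductionAt_baseChange_of_hasGoodReductionAtPrime hyp.ordinary.1 v hpv
  have hurv : ∀ v : HeightOneSpectrum (𝓞 K), ((p : ℕ) : 𝓞 K) ∈ v.asIdeal → (W.baseChange K).HasUnitRootAt v := by
    intro v hpv
    rw [WeierstrassCurve.hasUnitRootAt_iff, WeierstrassCurve.ringChar_residueField_eq v (Fact.out : p.Prime) hpv]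
    exact W.not_dvd_frobeniusTraceAt_baseChange_of_isOrdinaryAt hyp.ordinary v hpv
  have hordv : ∀ v : HeightOneSpectrum (𝓞 K), ((p : ℕ) : 𝓞 K) ∈ v.asIdeal →
      ∃ P : localPoints (W.baseChange K) (v.adicCompletion K),
        (p : ℤ) • P = 0 ∧ P ∉ (W.baseChange K).localKernelOfReduction v :=
    fun v hpv ↦ (W.baseChange K).exists_ordinaryPoint_local_of_not_dvd_frobeniusTraceAt v (hgoodv v hpv) hpv
      (W.not_dvd_frobeniusTraceAt_baseChange_of_isOrdinaryAt hyp.ordinary v hpv)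
  have hramv : ∀ v : HeightOneSpectrum (𝓞 K), ((p : ℕ) : 𝓞 K) ∈ v.asIdeal →
      ∃ 𝔓 ∈ v.primesAbove, ¬ 𝔓.inertia (absoluteGaloisGroup K) ≤ κ.kerSubgroup := fun v hpv ↦
    ⟨adicCompletionPrime K v, adicCompletionPrime_mem_primesAbove K v,
      ZpExtension.inertia_not_le_kerSubgroup_of_isAnticyclotomic hK hyp.p_ne_two κ hyp.anticyclotomic hpv
        (adicCompletionPrime_mem_primesAbove K v)⟩
  refine ⟨2 * p ^ s, p ^ s + 1, fun m hm hm₁ ↦ ?_⟩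
  letI := IwasawaAlgebra.isDomain_quotient_X_pow_add_C p hm
  letI := IwasawaAlgebra.isDiscreteValuationRing_quotient_X_pow_add_C p hm
  haveI := IwasawaAlgebra.EisensteinCoeff.isLocalRing_succ p hm
  letI := IwasawaAlgebra.EisensteinCoeff.algebraOfSpecSucc p m
  haveI := W.isScalarTower_algebraOfSpecSucc (K := K) (p := p) (m := m)
  letI := W.residueModuleSucc (K := K) (p := p) hm
  intro S hpS hbad hSN hSσ L hL hLS jbar' cd Dd fs hy hπ he' hπX hek
  refine ⟨0, fun j _ v hvS hpv ↦ ?_⟩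
  have hms : p ^ s < m := by omega
  have hobt2 := hs v hpv
  obtain ⟨σ₀, hσ₀⟩ := hobt2
  -- the per-place statement on the setting's tower (`St.T = eisensteinTower`, `St.t_k.cond (inr v) = F_𝔮(v)_{k+1}` by `rfl`)
  refine readoutLocalIndexP_at W κ hm _ _ hy.killed hy.ker_red hπ he' hπX hek _ v hpv (hgoodv v hpv) (hordv v hpv) σ₀
    hσ₀ hms j ?_ ?_
  · exact fun k ↦ (congrFun (W.eisensteinDVRSetting_t_cond (κ.unitTwist (-1)) hm S hpS hbad L hL hLS jbar' cd Dd fs k)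
      (Sum.inr v)).trans (ZpExtension.eisensteinSelmerStructure_inr_of_mem _ _ _ _ _ _ _ hpv)
  · exact W.exists_quotient_cocycle_principal_of_eisensteinTowerReadout_mem_selmerInfty_of_localKerOver_le κ hm _ _
      hy.killed hy.ker_red hπ he' hπX hek hyp.topGenerator v hpv (hgoodv v hpv) (hordv v hpv)
      (hKS K W p κ v hK hyp.p_ne_two hHp hyp.anticyclotomic hpv (hgoodv v hpv) (hurv v hpv) (hramv v hpv)).le

end Summit.BirchSwinnertonDyer.BirchSwinnertonDyer.Theorems.HeegnerMuPartControlGlue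

end
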